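import Mathlib
import Literature.MathematicalPhysics.QuantumFieldTheory.Balaban1983to89.B10LargeFieldSum
import Literature.MathematicalPhysics.QuantumFieldTheory.Balaban1983to89.B10Assembly

/-!
# `Summit.QuantumFields.Balaban3D.Proofs.LargeFieldKnitAdm` — lane «pub-balaban3d» (Bałaban, CMP **102** (1985) 255–275, d = 3
# lattice UV stability AS PRINTED), prover seat p2: the large-field resummation of pp. 273–274 RESTRICTED TO ADMISSIBLE HISTORIES

HONEST FRAMING (lane PLAN.md §0).  Nothing of [B10] = [Balaban1985UV3] is asserted.  This is `…Proofs.LargeFieldKnit.largeFieldControl_explicit`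
(the 4D cell's `B10LargeFieldSum.largeFieldControl_of_resummation` with `d = 3/ℓ` explicit) with ONE structural refinement the lane's
concrete carriers need: the small-factor and Z-term bounds are required only for histories satisfying a predicate `adm` (seat p1's
`Carriers.Regions.Hist.Admissible`: each recorded `P_j` lies in `Λ_j` — print's histories are admissible by construction, and the
lane's masses VANISH off admissible histories, `Carriers.Masses.stepWeight_of_not_admissible`), provided the domination of the
large-field functional uses the exponent bound only on admissible histories (`hdom`).  Reason: for a non-admissible plaquette record
the regions `Δ′(j,p′)` of (69)–(71) may pile up across scales, so the uniform overlap constant of `SmallFactorsAll` is not available,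
while print never meets such records.  Proof text = that of `LargeFieldKnit` (adapted from `B10LargeFieldSum` ll. 421–540) with
`adm` threaded through `hFB`; re-derived bookkeeping, no content of the series.
-/

noncomputable section

namespace Summit.QuantumFields.Balaban3D.Proofs.LargeFieldKnitAdm

open Literature.MathematicalPhysics.QuantumFieldTheory.Balaban1983to89
open B10LargeField B10LargeFieldSum
open Finset

variable {T : B10.TowerRun}

/-- **pp. 273–274, the large-field resummation with explicit `d = 3/ℓ`, FOR ADMISSIBLE HISTORIES** (see the module docstring):
as `…Proofs.LargeFieldKnit.largeFieldControl_explicit`, with the small factors (67)–(71) and the Z-term rate assumed only on histories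
with `adm k h`, and the domination hypothesis `hdom` using the exponent bound only there. [cite: Balaban1985UV3, pp.273–274] -/
theorem largeFieldControl_explicit_adm (X : HistModel T) (adm : (k : ℕ) → T.Hist k → Prop) {A c₁ gs cg ρ r₀ ℓ xK : ℝ}
    (hdom : ∀ k, k ≤ T.K → ∀ (U : T.Cfg k) (F : T.Hist k → ℝ) (B : Finset (ℕ × X.α) → ℝ),
      (∀ h, adm k h → F h ≤ B (X.disc k h)) →
        T.LF k U F ≤ ∑ Q ∈ (X.E k).powerset, Real.exp (B Q + X.A₀ * ∑ j ∈ Finset.range k, X.zvol k j Q))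
    (hSF : (∀ j, j ≤ T.K → 0 < T.g j ∧ T.g j ≤ gs) → ∀ k, k ≤ T.K → ∀ (U : T.Cfg k) (h : T.Hist k), adm k h →
      c₁ * ∑ e ∈ X.disc k h, B10.pFun T.b₀ T.p₀ (T.g e.1) ^ 2 / 4 ≤ T.mainT k h U)
    (hZ : ∀ k, k ≤ T.K → ∀ h : T.Hist k, adm k h →
      T.Zterm k h ≤ ∑ j ∈ Finset.range k, A * xlog (T.g j) * X.zvol k j (X.disc k h))
    (hV : ZvolCover X cg ρ r₀)
    (hA : 0 ≤ A) (hcg : 0 ≤ cg * ρ) (hr : 0 ≤ r₀) (hℓ : 0 < ℓ)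
    (hg : ∀ j, j ≤ T.K → 0 < T.g j ∧ T.g j ≤ gs) (hgs : gs ≤ 1)
    (hx : ∀ j, j ≤ T.K → xlog (T.g j) = xK + ((T.K - j : ℕ) : ℝ) * ℓ)
    (hp : r₀ * 3 + 2 ≤ 2 * T.p₀)
    (hb₁ : 8 * ((A + X.A₀) * (cg * ρ) ^ 3 / ℓ) ≤ c₁ * T.b₀ ^ 2)
    (hb₂ : 8 * (X.σ + ℓ) ≤ c₁ * T.b₀ ^ 2 * ℓ) :
    ∀ k, k ≤ T.K → ∀ U : T.Cfg k,
      T.LF k U (fun h => -(T.mainT k h U) + T.Zterm k h) ≤ Real.exp (3 / ℓ * T.sites k) := by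
  -- adapted from LQB `B10LargeFieldSum.largeFieldControl_of_resummation` (b2b-balaban-b10-g3), witness made explicit
  intro k hk U
  have hc₁ : 0 ≤ c₁ * T.b₀ ^ 2 := by
    have h8 : 0 ≤ 8 * ((A + X.A₀) * (cg * ρ) ^ 3 / ℓ) := by
      have := X.A₀_nonneg
      positivity
    linarith
  -- the unit x_j = 1 + log g_j⁻¹ along the run
  set x : ℕ → ℝ := fun j => xlog (T.g j) with hxdef
  have hx1 : ∀ j, j ≤ T.K → 1 ≤ x j := fun j hj => one_le_xlog (hg j hj).1 ((hg j hj).2.trans hgs)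
  have hxmono : ∀ i j, i ≤ j → j ≤ T.K → x j ≤ x i := by
    intro i j hij hj
    show xlog (T.g j) ≤ xlog (T.g i)
    rw [hx i (hij.trans hj), hx j hj]
    have : ((T.K - j : ℕ) : ℝ) ≤ ((T.K - i : ℕ) : ℝ) := by exact_mod_cast Nat.sub_le_sub_left hij _
    nlinarith
  have hxdiff : ∀ i, i ≤ k → x i - x k = ((k - i : ℕ) : ℝ) * ℓ := by
    intro i hi
    show xlog (T.g i) - xlog (T.g k) = ((k - i : ℕ) : ℝ) * ℓ
    rw [hx i (hi.trans hk), hx k hk]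
    have hcast : ((T.K - i : ℕ) : ℝ) = ((T.K - k : ℕ) : ℝ) + ((k - i : ℕ) : ℝ) := by
      rw [← Nat.cast_add]
      congr 1
      omega
    rw [hcast]
    ring
  have hp1 : 1 ≤ 2 * T.p₀ := by linarith
  have hκ : 0 ≤ c₁ * T.b₀ ^ 2 / 8 := by positivity
  -- per-source data: collar volume, accumulated rates, gain
  let V : ℕ × X.α → ℝ := fun e => (cg * ρ) ^ 3 * x e.1 ^ (3 * r₀)
  let S : ℕ × X.α → ℝ := fun e => ∑ j ∈ (Finset.range k).filter (fun j => e.1 ≤ j), (A * x j + X.A₀)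
  let gain : ℕ × X.α → ℝ := fun e => c₁ * (T.b₀ * x e.1 ^ T.p₀) ^ 2 / 4
  let θ : ℕ × X.α → ℝ := fun e => -(c₁ * (T.b₀ * x e.1 ^ T.p₀) ^ 2 / 8)
  -- the bounding function of the discrete data
  let B : Finset (ℕ × X.α) → ℝ := fun Q =>
    -(∑ e ∈ Q, gain e) + ∑ j ∈ Finset.range k, A * x j * X.zvol k j Q
  have hFB : ∀ h, adm k h → -(T.mainT k h U) + T.Zterm k h ≤ B (X.disc k h) := by
    intro h hadm
    have h1 := hSF hg k hk U h hadm
    have h2 := hZ k hk h hadm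
    have h3 : c₁ * ∑ e ∈ X.disc k h, B10.pFun T.b₀ T.p₀ (T.g e.1) ^ 2 / 4 = ∑ e ∈ X.disc k h, gain e := by
      rw [Finset.mul_sum]
      refine Finset.sum_congr rfl fun e _ => ?_
      simp only [gain, pFun_eq, hxdef]
      ring
    show -(T.mainT k h U) + T.Zterm k h
        ≤ -(∑ e ∈ X.disc k h, gain e) + ∑ j ∈ Finset.range k, A * x j * X.zvol k j (X.disc k h)
    linarith
  have hdom := hdom k hk U (fun h => -(T.mainT k h U) + T.Zterm k h) B hFB
  -- each history's exponent is at most the sum of the surviving (halved) small factors of its plaquettes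
  have hsummand : ∀ Q ∈ (X.E k).powerset,
      Real.exp (B Q + X.A₀ * ∑ j ∈ Finset.range k, X.zvol k j Q) ≤ Real.exp (∑ e ∈ Q, θ e) := by
    intro Q hQ
    rw [Finset.mem_powerset] at hQ
    apply Real.exp_le_exp.mpr
    have hz : ∀ j ∈ Finset.range k, (A * x j + X.A₀) * X.zvol k j Q
        ≤ (A * x j + X.A₀) * ∑ e ∈ Q.filter (fun e => e.1 ≤ j), V e := by
      intro j hj
      rw [Finset.mem_range] at hj
      have hxj : 1 ≤ x j := hx1 j (by omega)
      have hrate : 0 ≤ A * x j + X.A₀ := by nlinarith [X.A₀_nonneg]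
      exact mul_le_mul_of_nonneg_left (hV k hk Q hQ j hj) hrate
    have step1 : B Q + X.A₀ * ∑ j ∈ Finset.range k, X.zvol k j Q
        = -(∑ e ∈ Q, gain e) + ∑ j ∈ Finset.range k, (A * x j + X.A₀) * X.zvol k j Q := by
      show (-(∑ e ∈ Q, gain e) + ∑ j ∈ Finset.range k, A * x j * X.zvol k j Q)
          + X.A₀ * ∑ j ∈ Finset.range k, X.zvol k j Q
          = -(∑ e ∈ Q, gain e) + ∑ j ∈ Finset.range k, (A * x j + X.A₀) * X.zvol k j Q
      rw [Finset.mul_sum, add_assoc, ← Finset.sum_add_distrib]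
      congr 1
      refine Finset.sum_congr rfl fun j _ => ?_
      ring
    have step2 : ∑ j ∈ Finset.range k, (A * x j + X.A₀) * ∑ e ∈ Q.filter (fun e => e.1 ≤ j), V e
        = ∑ e ∈ Q, V e * S e := exchange_sum Q k (fun j => A * x j + X.A₀) V
    have step3 : ∀ e ∈ Q, -(gain e) + V e * S e ≤ θ e := by
      intro e he
      have heE : e ∈ X.E k := hQ he
      have hik : e.1 < k := X.E_lt k e heE
      exact perSource_net_le (x := x) hA X.A₀_nonneg hcg hℓ hik
        (fun j hj => hx1 j (hj.trans hk)) (fun j hij hj => hxmono e.1 j hij (hj.trans hk))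
        (hxdiff e.1 hik.le) hp hb₁
    calc B Q + X.A₀ * ∑ j ∈ Finset.range k, X.zvol k j Q
        = -(∑ e ∈ Q, gain e) + ∑ j ∈ Finset.range k, (A * x j + X.A₀) * X.zvol k j Q := step1
      _ ≤ -(∑ e ∈ Q, gain e) + ∑ j ∈ Finset.range k, (A * x j + X.A₀) * ∑ e ∈ Q.filter (fun e => e.1 ≤ j), V e :=
          by linarith [Finset.sum_le_sum hz]
      _ = -(∑ e ∈ Q, gain e) + ∑ e ∈ Q, V e * S e := by rw [step2]
      _ = ∑ e ∈ Q, (-(gain e) + V e * S e) := by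
          rw [Finset.sum_add_distrib, Finset.sum_neg_distrib]
      _ ≤ ∑ e ∈ Q, θ e := Finset.sum_le_sum step3
  -- the surviving factor at scale j is at most e^{−κ x_j}, κ = c₁b₀²/8
  have hθ : ∀ e ∈ X.E k, Real.exp (θ e) ≤ Real.exp (-(c₁ * T.b₀ ^ 2 / 8 * x e.1)) := by
    intro e he
    have hik : e.1 < k := X.E_lt k e he
    have hxe : 1 ≤ x e.1 := hx1 e.1 (by omega)
    have hx0 : 0 ≤ x e.1 := by linarith
    apply Real.exp_le_exp.mpr
    have h2 : (x e.1 ^ T.p₀) ^ 2 = x e.1 ^ (2 * T.p₀) := by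
      rw [mul_comm, Real.rpow_mul hx0, Real.rpow_two]
    have h3 : x e.1 ≤ x e.1 ^ (2 * T.p₀) := by
      have := Real.rpow_le_rpow_of_exponent_le hxe hp1
      rwa [Real.rpow_one] at this
    have h4 : c₁ * T.b₀ ^ 2 / 8 * x e.1 ≤ c₁ * T.b₀ ^ 2 / 8 * (x e.1 ^ T.p₀) ^ 2 := by
      rw [h2]
      exact mul_le_mul_of_nonneg_left h3 hκ
    show -(c₁ * (T.b₀ * x e.1 ^ T.p₀) ^ 2 / 8) ≤ -(c₁ * T.b₀ ^ 2 / 8 * x e.1)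
    rw [mul_pow]
    linarith
  have hxj : ∀ j, j < k → 1 + ((k - j : ℕ) : ℝ) * ℓ ≤ x j := by
    intro j hj
    have := hxdiff j hj.le
    have := hx1 k hk
    linarith
  have hκℓ : X.σ + ℓ ≤ c₁ * T.b₀ ^ 2 / 8 * ℓ := by linarith
  have hfinal : ∑ e ∈ X.E k, Real.exp (θ e) ≤ 3 / ℓ * T.sites k := by
    calc ∑ e ∈ X.E k, Real.exp (θ e) ≤ ∑ e ∈ X.E k, Real.exp (-(c₁ * T.b₀ ^ 2 / 8 * x e.1)) :=
          Finset.sum_le_sum hθ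
      _ ≤ ∑ j ∈ Finset.range k,
            3 * Real.exp (X.σ * ((k - j : ℕ) : ℝ)) * T.sites k * Real.exp (-(c₁ * T.b₀ ^ 2 / 8 * x j)) :=
          sum_candidates_le X k (fun j => Real.exp (-(c₁ * T.b₀ ^ 2 / 8 * x j))) fun j => (Real.exp_pos _).le
      _ ≤ 3 * T.sites k / ℓ :=
          scaleEntropy_sum_le x k hℓ (T.sites_nonneg k) hκ hκℓ hxj
      _ = 3 / ℓ * T.sites k := by ring
  calc T.LF k U (fun h => -(T.mainT k h U) + T.Zterm k h)
      ≤ ∑ Q ∈ (X.E k).powerset, Real.exp (B Q + X.A₀ * ∑ j ∈ Finset.range k, X.zvol k j Q) := hdom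
    _ ≤ ∑ Q ∈ (X.E k).powerset, Real.exp (∑ e ∈ Q, θ e) := Finset.sum_le_sum hsummand
    _ ≤ Real.exp (∑ e ∈ X.E k, Real.exp (θ e)) := sum_powerset_exp_sum_le _ θ
    _ ≤ Real.exp (3 / ℓ * T.sites k) := Real.exp_le_exp.mpr hfinal

/-- The same on the printed flow `g_j = g(L^jε)^{1/2}`, `ℓ = ½ log L`, `σ = 3 log L` (as `…LargeFieldKnit.largeFieldControl_explicit_gRun`),
for admissible histories. [cite: Balaban1985UV3, pp.273–274] -/
theorem largeFieldControl_explicit_gRun_adm (X : HistModel T) (adm : (k : ℕ) → T.Hist k → Prop)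
    {A c₁ gs cg ρ r₀ g L ε : ℝ}
    (hdom : ∀ k, k ≤ T.K → ∀ (U : T.Cfg k) (F : T.Hist k → ℝ) (B : Finset (ℕ × X.α) → ℝ),
      (∀ h, adm k h → F h ≤ B (X.disc k h)) →
        T.LF k U F ≤ ∑ Q ∈ (X.E k).powerset, Real.exp (B Q + X.A₀ * ∑ j ∈ Finset.range k, X.zvol k j Q))
    (hSF : (∀ j, j ≤ T.K → 0 < T.g j ∧ T.g j ≤ gs) → ∀ k, k ≤ T.K → ∀ (U : T.Cfg k) (h : T.Hist k), adm k h →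
      c₁ * ∑ e ∈ X.disc k h, B10.pFun T.b₀ T.p₀ (T.g e.1) ^ 2 / 4 ≤ T.mainT k h U)
    (hZ : ∀ k, k ≤ T.K → ∀ h : T.Hist k, adm k h →
      T.Zterm k h ≤ ∑ j ∈ Finset.range k, A * xlog (T.g j) * X.zvol k j (X.disc k h))
    (hV : ZvolCover X cg ρ r₀)
    (hA : 0 ≤ A) (hcg : 0 ≤ cg * ρ) (hr : 0 ≤ r₀) (hg0 : 0 < g) (hL : 1 < L) (hε : 0 < ε)
    (hrun : ∀ j, T.g j = B10.gRun g L ε j)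
    (hg : ∀ j, j ≤ T.K → 0 < T.g j ∧ T.g j ≤ gs) (hgs : gs ≤ 1)
    (hσ : X.σ = 3 * Real.log L)
    (hp : r₀ * 3 + 2 ≤ 2 * T.p₀)
    (hb₁ : 8 * ((A + X.A₀) * (cg * ρ) ^ 3 / (Real.log L / 2)) ≤ c₁ * T.b₀ ^ 2)
    (hb₂ : 56 ≤ c₁ * T.b₀ ^ 2) :
    ∀ k, k ≤ T.K → ∀ U : T.Cfg k,
      T.LF k U (fun h => -(T.mainT k h U) + T.Zterm k h) ≤ Real.exp (6 / Real.log L * T.sites k) := by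
  have hlog : 0 < Real.log L := Real.log_pos hL
  have hℓ : 0 < Real.log L / 2 := by positivity
  have hmain := largeFieldControl_explicit_adm X adm (xK := xlog (T.g T.K)) hdom hSF hZ hV hA hcg hr hℓ hg hgs
    (fun j hj => by rw [hrun j, hrun T.K]; exact xlog_gRun g L ε hg0 (by linarith) hε hj) hp hb₁
    (by rw [hσ]; nlinarith)
  intro k hk U
  have h6 : (3 : ℝ) / (Real.log L / 2) = 6 / Real.log L := by
    field_simp
    ring
  rw [← h6]
  exact hmain k hk U

/-- **`B10Assembly.LeafSystem.lf` AS A THEOREM, admissible-histories form:** for constants `C` with `C.d = 6/log C.L`, literally the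
field `lf` of `LeafSystem`/`ConcreteLeaves`, from the admissibility-restricted leaves. [cite: Balaban1985UV3, pp.273–274] -/
theorem lf_leaf_of_leaves_adm (C : B10Assembly.Consts) (hd : C.d = 6 / Real.log C.L) (X : HistModel T)
    (adm : (k : ℕ) → T.Hist k → Prop)
    {A c₁ gs cg ρ r₀ ε : ℝ}
    (hdom : ∀ k, k ≤ T.K → ∀ (U : T.Cfg k) (F : T.Hist k → ℝ) (B : Finset (ℕ × X.α) → ℝ),
      (∀ h, adm k h → F h ≤ B (X.disc k h)) →
        T.LF k U F ≤ ∑ Q ∈ (X.E k).powerset, Real.exp (B Q + X.A₀ * ∑ j ∈ Finset.range k, X.zvol k j Q))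
    (hSF : (∀ j, j ≤ T.K → 0 < T.g j ∧ T.g j ≤ gs) → ∀ k, k ≤ T.K → ∀ (U : T.Cfg k) (h : T.Hist k), adm k h →
      c₁ * ∑ e ∈ X.disc k h, B10.pFun T.b₀ T.p₀ (T.g e.1) ^ 2 / 4 ≤ T.mainT k h U)
    (hZ : ∀ k, k ≤ T.K → ∀ h : T.Hist k, adm k h →
      T.Zterm k h ≤ ∑ j ∈ Finset.range k, A * xlog (T.g j) * X.zvol k j (X.disc k h))
    (hV : ZvolCover X cg ρ r₀)
    (hA : 0 ≤ A) (hcg : 0 ≤ cg * ρ) (hr : 0 ≤ r₀) (hε : 0 < ε)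
    (hrun : ∀ j, T.g j = B10.gRun C.g C.L ε j)
    (hg : ∀ j, j ≤ T.K → 0 < T.g j ∧ T.g j ≤ gs) (hgs : gs ≤ 1)
    (hσ : X.σ = 3 * Real.log C.L)
    (hp : r₀ * 3 + 2 ≤ 2 * T.p₀)
    (hb₁ : 8 * ((A + X.A₀) * (cg * ρ) ^ 3 / (Real.log C.L / 2)) ≤ c₁ * T.b₀ ^ 2)
    (hb₂ : 56 ≤ c₁ * T.b₀ ^ 2) :
    ∀ k, k ≤ T.K → ∀ U : T.Cfg k,
      T.LF k U (fun h => -(T.mainT k h U) + T.Zterm k h) ≤ Real.exp (C.d * T.sites k) := by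
  rw [hd]
  exact largeFieldControl_explicit_gRun_adm X adm hdom hSF hZ hV hA hcg hr C.g_pos C.one_lt_L hε hrun hg hgs hσ hp hb₁ hb₂

end Summit.QuantumFields.Balaban3D.Proofs.LargeFieldKnitAdm

end
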